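import Summits.AtomisticToContinuum.HydrodynamicLimit.Theorems.LambertianContactSwapLambertianEulerProductionSplitTools
import Summits.AtomisticToContinuum.HydrodynamicLimit.Theorems.LambertianContactSwapLambertianEulerWindowEntropyInequality
import HarnessLib

/-!
# Window tools for the kinetic log-heart reduction: clamp split, tail remainder, bounded windows, window sums, the entropy step (line `Sketch`, crux stmt-11854)

Support file (`--supports stmt-AtomisticToContinuum-11854`).  Generic measure-theoretic bookkeeping, along the Lambertian flow `Λ` under
`λ = λ_N ⊗ γ^ℕ` (local Gibbs data ⊗ noise, `0 < σ < 1/2`), for window functionals `E_λ[∫_s^{s′} Σ_i G(r, (Λ_r)_i) dr]` of a jointly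
measurable one-body observable `G` of cubic growth in the velocity, with a velocity clamp `|v − U(r, x)| ≤ V` (`U` continuous):

* `neg_window_le_clamp_add_remainder` — `−E[∫ΣG] ≤ −E[∫Σ clamp_V G] + E[∫Σ |G|·1{|v−U|>V}]`;
* `remainder_le_of_tails` — the clamp remainder through fixed-time tail bounds `E_λ[Σ_i (1+|v_i(r)|)³ 1{|v_i(r)−U|>V}] ≤ D` on `[s,s′]`
  (Fubini): `≤ (s′−s) C D`;
* `abs_window_le` — a bounded observable has window functional `≤ (b−a)(N+1)B`;
* `window_sum_eq` — splitting `[s,s′]` into `m` equal windows;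
* `neg_window_le_of_ent` — the window entropy inequality with restart (ENT, p136234) at rate `γ/h` with the entropy and the
  log-moment-generating function bounded: `−E[∫_a^{a+h} ΣG] ≤ (h/γ)(M + Γ)`.

These are the glue of `…LambertianEulerKineticHeartOfInputs` (KCW-Λ → TL1G-Λ → P3Λ-log).  Lead prover-line-stmt-AtomisticToContinuum-11854-c7-0,
2026-08-17.  [cite: Yau1991, §2]
-/

noncomputable section

namespace Summit.AtomisticToContinuum.HydrodynamicLimit.Theorems.LambertianContactSwapLambertianEulerKineticWindowTools

open scoped BigOperators Topology ENNReal
open MeasureTheory ProbabilityTheory Filter Set InformationTheory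
open Literature.MathematicalPhysics.KineticTheory
open Literature.Analysis.FluidPDE Literature.Analysis.FluidPDE.Alexander
open Literature.Analysis.FunctionSpaces
open Summit.AtomisticToContinuum.HydrodynamicLimit.Theorems.LambertianContactSwapLambertianEulerProductionSplitTools
open Summit.AtomisticToContinuum.HydrodynamicLimit.Theorems.LambertianContactSwapLambertianEulerWindowEntropyInequality
open Summit.AtomisticToContinuum.HydrodynamicLimit.Theorems

variable {σ : ℝ} {a₀ θ₀ : T3 → ℝ} {u₀ : T3 → V3} {N : ℕ}

/-! ## §1 Measurability of the clamp and of the remainder -/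

/-- The clamp set `{(r, x, v) | |v − U(r, x)| ≤ V}` is measurable for continuous `U`. [folklore] -/
theorem measurableSet_clamp : ∀ {U : ℝ × T3 → V3}, Continuous U → ∀ V : ℝ, MeasurableSet {q : ℝ × (T3 × V3) | ‖q.2.2 - U (q.1, q.2.1)‖ ≤ V} := by
  intro U hU V
  have hc : Continuous fun q : ℝ × (T3 × V3) => ‖q.2.2 - U (q.1, q.2.1)‖ := by fun_prop
  exact measurableSet_le hc.measurable measurable_const

/-- The velocity-clamped observable `clamp_V G` is measurable. [folklore] -/
theorem measurable_clampObs {G : ℝ × (T3 × V3) → ℝ} (hG : Measurable G) {U : ℝ × T3 → V3} (hU : Continuous U) (V : ℝ) :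
    Measurable fun q : ℝ × (T3 × V3) => if ‖q.2.2 - U (q.1, q.2.1)‖ ≤ V then G q else 0 :=
  Measurable.ite (measurableSet_clamp hU V) hG measurable_const

/-- The clamp remainder `|G| · 1{|v − U| > V}` is measurable. [folklore] -/
theorem measurable_remObs {G : ℝ × (T3 × V3) → ℝ} (hG : Measurable G) {U : ℝ × T3 → V3} (hU : Continuous U) (V : ℝ) :
    Measurable fun q : ℝ × (T3 × V3) => if V < ‖q.2.2 - U (q.1, q.2.1)‖ then |G q| else 0 := by
  have hc : Continuous fun q : ℝ × (T3 × V3) => ‖q.2.2 - U (q.1, q.2.1)‖ := by fun_prop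
  exact Measurable.ite (measurableSet_lt measurable_const hc.measurable) (by fun_prop) measurable_const

/-- The cubic tail weight `(1 + |v|)³ · 1{|v − U| > V}` is measurable. [folklore] -/
theorem measurable_tailObs {U : ℝ × T3 → V3} (hU : Continuous U) (V : ℝ) :
    Measurable fun q : ℝ × (T3 × V3) => if V < ‖q.2.2 - U (q.1, q.2.1)‖ then (1 + ‖q.2.2‖) ^ 3 else 0 := by
  have hc : Continuous fun q : ℝ × (T3 × V3) => ‖q.2.2 - U (q.1, q.2.1)‖ := by fun_prop
  exact Measurable.ite (measurableSet_lt measurable_const hc.measurable) (by fun_prop) measurable_const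

/-! ## §2 The clamp split and the tail remainder -/

/-- **CLAMP SPLIT.** For a measurable one-body observable `G` of cubic growth on `[s,s′]` and a continuous clamp centre `U`:
`−E_λ[∫_s^{s′} Σ_i G] ≤ −E_λ[∫_s^{s′} Σ_i clamp_V G] + E_λ[∫_s^{s′} Σ_i |G| 1{|v − U| > V}]` along `Λ` (all three window functionals are
integrable, `integrable_window_functional`; pathwise `clamp_V G − G ≤ |G| 1{>V}`). [folklore] -/
theorem neg_window_le_clamp_add_remainder (hσ : 0 < σ) (hσ' : σ < 2⁻¹) (ha : Continuous a₀) (hθ : Continuous θ₀)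
    (hu : Continuous u₀) (ha0 : ∀ x, 0 < a₀ x) (hθ0 : ∀ x, 0 < θ₀ x)
    (Φ : HardSphereFlow (Torus.geometry (Fin 3)) (hsDiameter σ N) (N + 1)) {G : ℝ × (T3 × V3) → ℝ} (hG : Measurable G)
    {s s' C : ℝ} (hss' : s ≤ s') (hC0 : 0 ≤ C) (hC : ∀ r ∈ Set.Icc s s', ∀ y : T3 × V3, |G (r, y)| ≤ C * (1 + ‖y.2‖) ^ 3)
    {U : ℝ × T3 → V3} (hU : Continuous U) (V : ℝ) :
    -(∫ p, (∫ r in s..s', ∑ i, G (r, lambertFlow (Torus.geometry (Fin 3)) (hsDiameter σ N) p.2 p.1 r i))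
        ∂((localGibbsLaw σ a₀ u₀ θ₀ N Φ).prod (lambertNoise (Fin 3)))) ≤
      -(∫ p, (∫ r in s..s', ∑ i, (if ‖(lambertFlow (Torus.geometry (Fin 3)) (hsDiameter σ N) p.2 p.1 r i).2 -
            U (r, (lambertFlow (Torus.geometry (Fin 3)) (hsDiameter σ N) p.2 p.1 r i).1)‖ ≤ V then
            G (r, lambertFlow (Torus.geometry (Fin 3)) (hsDiameter σ N) p.2 p.1 r i) else 0))
          ∂((localGibbsLaw σ a₀ u₀ θ₀ N Φ).prod (lambertNoise (Fin 3)))) +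
      ∫ p, (∫ r in s..s', ∑ i, (if V < ‖(lambertFlow (Torus.geometry (Fin 3)) (hsDiameter σ N) p.2 p.1 r i).2 -
            U (r, (lambertFlow (Torus.geometry (Fin 3)) (hsDiameter σ N) p.2 p.1 r i).1)‖ then
            |G (r, lambertFlow (Torus.geometry (Fin 3)) (hsDiameter σ N) p.2 p.1 r i)| else 0))
          ∂((localGibbsLaw σ a₀ u₀ θ₀ N Φ).prod (lambertNoise (Fin 3))) := by
  -- the three observables
  set Gc : ℝ × (T3 × V3) → ℝ := fun q => if ‖q.2.2 - U (q.1, q.2.1)‖ ≤ V then G q else 0 with hGc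
  set Gr : ℝ × (T3 × V3) → ℝ := fun q => if V < ‖q.2.2 - U (q.1, q.2.1)‖ then |G q| else 0 with hGr
  have hGcm : Measurable Gc := measurable_clampObs hG hU V
  have hGrm : Measurable Gr := measurable_remObs hG hU V
  have hGcb : ∀ r ∈ Set.Icc s s', ∀ y : T3 × V3, |Gc (r, y)| ≤ C * (1 + ‖y.2‖) ^ 3 := by
    intro r hr y
    simp only [hGc]
    split_ifs
    · exact hC r hr y
    · rw [abs_zero]; positivity
  have hGrb : ∀ r ∈ Set.Icc s s', ∀ y : T3 × V3, |Gr (r, y)| ≤ C * (1 + ‖y.2‖) ^ 3 := by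
    intro r hr y
    simp only [hGr]
    split_ifs
    · rw [abs_abs]; exact hC r hr y
    · rw [abs_zero]; positivity
  have hptw : ∀ r ∈ Set.Icc s s', ∀ y : T3 × V3, Gc (r, y) - G (r, y) ≤ Gr (r, y) := by
    intro r _ y
    simp only [hGc, hGr]
    by_cases h : ‖y.2 - U (r, y.1)‖ ≤ V
    · simp [h, not_lt.2 h]
    · simp only [h, not_le.1 h, if_false, if_true, zero_sub]
      exact neg_le_abs _
  obtain ⟨-, hIG, hAG⟩ := integrable_window_functional hσ hσ' ha hθ hu ha0 hθ0 Φ hG hss' hC0 hC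
  obtain ⟨-, hIGc, hAGc⟩ := integrable_window_functional hσ hσ' ha hθ hu ha0 hθ0 Φ hGcm hss' hC0 hGcb
  obtain ⟨-, hIGr, hAGr⟩ := integrable_window_functional hσ hσ' ha hθ hu ha0 hθ0 Φ hGrm hss' hC0 hGrb
  -- pathwise comparison of the window integrals
  have hpath : ∀ᵐ p ∂((localGibbsLaw σ a₀ u₀ θ₀ N Φ).prod (lambertNoise (Fin 3))),
      (∫ r in s..s', ∑ i, Gc (r, lambertFlow (Torus.geometry (Fin 3)) (hsDiameter σ N) p.2 p.1 r i)) -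
        (∫ r in s..s', ∑ i, G (r, lambertFlow (Torus.geometry (Fin 3)) (hsDiameter σ N) p.2 p.1 r i)) ≤
      ∫ r in s..s', ∑ i, Gr (r, lambertFlow (Torus.geometry (Fin 3)) (hsDiameter σ N) p.2 p.1 r i) := by
    filter_upwards [hAG, hAGc, hAGr] with p hpG hpGc hpGr
    have iG : IntervalIntegrable (fun r => ∑ i, G (r, lambertFlow (Torus.geometry (Fin 3)) (hsDiameter σ N) p.2 p.1 r i))
        volume s s' := (intervalIntegrable_iff_integrableOn_Ioc_of_le hss').2 hpG
    have iGc : IntervalIntegrable (fun r => ∑ i, Gc (r, lambertFlow (Torus.geometry (Fin 3)) (hsDiameter σ N) p.2 p.1 r i))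
        volume s s' := (intervalIntegrable_iff_integrableOn_Ioc_of_le hss').2 hpGc
    have iGr : IntervalIntegrable (fun r => ∑ i, Gr (r, lambertFlow (Torus.geometry (Fin 3)) (hsDiameter σ N) p.2 p.1 r i))
        volume s s' := (intervalIntegrable_iff_integrableOn_Ioc_of_le hss').2 hpGr
    rw [← intervalIntegral.integral_sub iGc iG]
    refine intervalIntegral.integral_mono_on hss' (iGc.sub iG) iGr fun r hr => ?_
    rw [← Finset.sum_sub_distrib]
    exact Finset.sum_le_sum fun i _ => hptw r hr _
  have key : (∫ p, (∫ r in s..s', ∑ i, Gc (r, lambertFlow (Torus.geometry (Fin 3)) (hsDiameter σ N) p.2 p.1 r i))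
        ∂((localGibbsLaw σ a₀ u₀ θ₀ N Φ).prod (lambertNoise (Fin 3)))) -
      (∫ p, (∫ r in s..s', ∑ i, G (r, lambertFlow (Torus.geometry (Fin 3)) (hsDiameter σ N) p.2 p.1 r i))
        ∂((localGibbsLaw σ a₀ u₀ θ₀ N Φ).prod (lambertNoise (Fin 3)))) ≤
      ∫ p, (∫ r in s..s', ∑ i, Gr (r, lambertFlow (Torus.geometry (Fin 3)) (hsDiameter σ N) p.2 p.1 r i))
        ∂((localGibbsLaw σ a₀ u₀ θ₀ N Φ).prod (lambertNoise (Fin 3))) := by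
    rw [← integral_sub hIGc hIG]
    exact integral_mono_ae (hIGc.sub hIG) hIGr hpath
  linarith

/-- **TAIL REMAINDER.** If at every time `r ∈ [s,s′]` the cubic tail weight of `Λ_r` beyond the clamp has expectation `≤ D`, then the
clamp remainder of a `C`-cubic observable is `≤ (s′−s) C D` (Fubini on `λ ⊗ dr`, comparison for a.e. `r`). [folklore] -/
theorem remainder_le_of_tails (hσ : 0 < σ) (hσ' : σ < 2⁻¹) (ha : Continuous a₀) (hθ : Continuous θ₀)
    (hu : Continuous u₀) (ha0 : ∀ x, 0 < a₀ x) (hθ0 : ∀ x, 0 < θ₀ x)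
    (Φ : HardSphereFlow (Torus.geometry (Fin 3)) (hsDiameter σ N) (N + 1)) {G : ℝ × (T3 × V3) → ℝ} (hG : Measurable G)
    {s s' C : ℝ} (hss' : s ≤ s') (hC0 : 0 ≤ C) (hC : ∀ r ∈ Set.Icc s s', ∀ y : T3 × V3, |G (r, y)| ≤ C * (1 + ‖y.2‖) ^ 3)
    {U : ℝ × T3 → V3} (hU : Continuous U) (V : ℝ) {D : ℝ}
    (hD : ∀ r ∈ Set.Icc s s',
      ∫ p, (∑ i, (if V < ‖(lambertFlow (Torus.geometry (Fin 3)) (hsDiameter σ N) p.2 p.1 r i).2 -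
          U (r, (lambertFlow (Torus.geometry (Fin 3)) (hsDiameter σ N) p.2 p.1 r i).1)‖ then
          (1 + ‖(lambertFlow (Torus.geometry (Fin 3)) (hsDiameter σ N) p.2 p.1 r i).2‖) ^ 3 else 0))
        ∂((localGibbsLaw σ a₀ u₀ θ₀ N Φ).prod (lambertNoise (Fin 3))) ≤ D) :
    ∫ p, (∫ r in s..s', ∑ i, (if V < ‖(lambertFlow (Torus.geometry (Fin 3)) (hsDiameter σ N) p.2 p.1 r i).2 -
          U (r, (lambertFlow (Torus.geometry (Fin 3)) (hsDiameter σ N) p.2 p.1 r i).1)‖ then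
          |G (r, lambertFlow (Torus.geometry (Fin 3)) (hsDiameter σ N) p.2 p.1 r i)| else 0))
        ∂((localGibbsLaw σ a₀ u₀ θ₀ N Φ).prod (lambertNoise (Fin 3))) ≤ (s' - s) * (C * D) := by
  have hσ2 : σ ≤ 1 / 2 := by rw [one_div]; exact hσ'.le
  haveI : IsProbabilityMeasure (localGibbsLaw σ a₀ u₀ θ₀ N Φ) :=
    isProbabilityMeasure_localGibbsLaw ha hθ hu ha0 hθ0 hσ2 N Φ
  set P := (localGibbsLaw σ a₀ u₀ θ₀ N Φ).prod (lambertNoise (Fin 3)) with hP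
  set ν : Measure ℝ := volume.restrict (Set.Ioc s s') with hν
  set Gr : ℝ × (T3 × V3) → ℝ := fun q => if V < ‖q.2.2 - U (q.1, q.2.1)‖ then |G q| else 0 with hGr
  set Gd : ℝ × (T3 × V3) → ℝ := fun q => if V < ‖q.2.2 - U (q.1, q.2.1)‖ then (1 + ‖q.2.2‖) ^ 3 else 0 with hGd
  have hGrm : Measurable Gr := measurable_remObs hG hU V
  have hGdm : Measurable Gd := measurable_tailObs hU V
  have hGrb : ∀ r ∈ Set.Icc s s', ∀ y : T3 × V3, |Gr (r, y)| ≤ C * (1 + ‖y.2‖) ^ 3 := by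
    intro r hr y
    simp only [hGr]
    split_ifs
    · rw [abs_abs]; exact hC r hr y
    · rw [abs_zero]; positivity
  have hGdb : ∀ r ∈ Set.Icc s s', ∀ y : T3 × V3, |Gd (r, y)| ≤ 1 * (1 + ‖y.2‖) ^ 3 := by
    intro r _ y
    simp only [hGd, one_mul]
    split_ifs
    · rw [abs_of_nonneg (by positivity)]
    · rw [abs_zero]; positivity
  have hptw : ∀ r ∈ Set.Icc s s', ∀ y : T3 × V3, Gr (r, y) ≤ C * Gd (r, y) := by
    intro r hr y
    simp only [hGr, hGd]
    split_ifs
    · exact (hC r hr y)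
    · simp
  obtain ⟨hPr, -, -⟩ := integrable_window_functional hσ hσ' ha hθ hu ha0 hθ0 Φ hGrm hss' hC0 hGrb
  obtain ⟨hPd, -, -⟩ := integrable_window_functional hσ hσ' ha hθ hu ha0 hθ0 Φ hGdm hss' zero_le_one hGdb
  -- Fubini: integrate in `p` first
  have hswap : (∫ p, (∫ r in s..s', ∑ i, Gr (r, lambertFlow (Torus.geometry (Fin 3)) (hsDiameter σ N) p.2 p.1 r i)) ∂P) =
      ∫ r, (∫ p, ∑ i, Gr (r, lambertFlow (Torus.geometry (Fin 3)) (hsDiameter σ N) p.2 p.1 r i) ∂P) ∂ν := by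
    simp only [intervalIntegral.integral_of_le hss', hν]
    exact integral_integral_swap hPr
  rw [hswap]
  -- comparison for `ν`-a.e. `r`
  have haer : ∀ᵐ r ∂ν, Integrable (fun p : Config (N + 1) (Fin 3) T3 × (ℕ → V3) =>
      ∑ i, Gr (r, lambertFlow (Torus.geometry (Fin 3)) (hsDiameter σ N) p.2 p.1 r i)) P := hPr.prod_left_ae
  have haed : ∀ᵐ r ∂ν, Integrable (fun p : Config (N + 1) (Fin 3) T3 × (ℕ → V3) =>
      ∑ i, Gd (r, lambertFlow (Torus.geometry (Fin 3)) (hsDiameter σ N) p.2 p.1 r i)) P := hPd.prod_left_ae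
  have hmem : ∀ᵐ r ∂ν, r ∈ Set.Ioc s s' := by rw [hν]; exact ae_restrict_mem measurableSet_Ioc
  have hle : ∀ᵐ r ∂ν, (∫ p, ∑ i, Gr (r, lambertFlow (Torus.geometry (Fin 3)) (hsDiameter σ N) p.2 p.1 r i) ∂P) ≤ C * D := by
    filter_upwards [haer, haed, hmem] with r hr hd hrm
    have hrI : r ∈ Set.Icc s s' := Set.Ioc_subset_Icc_self hrm
    calc (∫ p, ∑ i, Gr (r, lambertFlow (Torus.geometry (Fin 3)) (hsDiameter σ N) p.2 p.1 r i) ∂P)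
        ≤ ∫ p, C * ∑ i, Gd (r, lambertFlow (Torus.geometry (Fin 3)) (hsDiameter σ N) p.2 p.1 r i) ∂P := by
          refine integral_mono hr (hd.const_mul C) fun p => ?_
          rw [Finset.mul_sum]
          exact Finset.sum_le_sum fun i _ => hptw r hrI _
      _ = C * ∫ p, ∑ i, Gd (r, lambertFlow (Torus.geometry (Fin 3)) (hsDiameter σ N) p.2 p.1 r i) ∂P := integral_const_mul _ _
      _ ≤ C * D := mul_le_mul_of_nonneg_left (hD r hrI) hC0
  haveI : IsFiniteMeasure ν := by rw [hν]; infer_instance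
  have hI1 : Integrable (fun r => ∫ p, ∑ i, Gr (r, lambertFlow (Torus.geometry (Fin 3)) (hsDiameter σ N) p.2 p.1 r i) ∂P) ν :=
    hPr.integral_prod_right
  calc (∫ r, (∫ p, ∑ i, Gr (r, lambertFlow (Torus.geometry (Fin 3)) (hsDiameter σ N) p.2 p.1 r i) ∂P) ∂ν)
      ≤ ∫ _r, C * D ∂ν := integral_mono_ae hI1 (integrable_const _) hle
    _ = (s' - s) * (C * D) := by
        rw [integral_const, smul_eq_mul, hν, measureReal_restrict_apply_univ, Real.volume_real_Ioc_of_le hss']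

/-! ## §3 Bounded observables: window bounds and window sums -/

/-- **A bounded observable has a bounded window functional**: `|E_λ[∫_a^b Σ_i F]| ≤ (b−a)(N+1)B` for `|F| ≤ B`, `a ≤ b`
(`λ` a probability law for `σ ≤ 1/2`). [folklore] -/
theorem abs_window_le (hσ2 : σ ≤ 1 / 2) (ha : Continuous a₀) (hθ : Continuous θ₀) (hu : Continuous u₀)
    (ha0 : ∀ x, 0 < a₀ x) (hθ0 : ∀ x, 0 < θ₀ x)
    (Φ : HardSphereFlow (Torus.geometry (Fin 3)) (hsDiameter σ N) (N + 1)) {F : ℝ × (T3 × V3) → ℝ} {B : ℝ}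
    (hB : ∀ q, |F q| ≤ B) {a b : ℝ} (hab : a ≤ b) :
    |∫ p, (∫ r in a..b, ∑ i, F (r, lambertFlow (Torus.geometry (Fin 3)) (hsDiameter σ N) p.2 p.1 r i))
        ∂((localGibbsLaw σ a₀ u₀ θ₀ N Φ).prod (lambertNoise (Fin 3)))| ≤ (b - a) * (((N : ℝ) + 1) * B) := by
  haveI : IsProbabilityMeasure (localGibbsLaw σ a₀ u₀ θ₀ N Φ) :=
    isProbabilityMeasure_localGibbsLaw ha hθ hu ha0 hθ0 hσ2 N Φ
  have hsum : ∀ (r : ℝ) (z : Config (N + 1) (Fin 3) T3), ‖∑ i, F (r, z i)‖ ≤ ((N : ℝ) + 1) * B := by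
    intro r z
    rw [Real.norm_eq_abs]
    calc |∑ i, F (r, z i)| ≤ ∑ i, |F (r, z i)| := Finset.abs_sum_le_sum_abs _ _
      _ ≤ ∑ _i : Fin (N + 1), B := Finset.sum_le_sum fun i _ => hB _
      _ = ((N : ℝ) + 1) * B := by
          simp only [Finset.sum_const, Finset.card_univ, Fintype.card_fin, nsmul_eq_mul, Nat.cast_add, Nat.cast_one]
  have hpath : ∀ p : Config (N + 1) (Fin 3) T3 × (ℕ → V3),
      ‖∫ r in a..b, ∑ i, F (r, lambertFlow (Torus.geometry (Fin 3)) (hsDiameter σ N) p.2 p.1 r i)‖ ≤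
        (b - a) * (((N : ℝ) + 1) * B) := by
    intro p
    have h := intervalIntegral.norm_integral_le_of_norm_le_const (a := a) (b := b) (C := ((N : ℝ) + 1) * B)
      (f := fun r => ∑ i, F (r, lambertFlow (Torus.geometry (Fin 3)) (hsDiameter σ N) p.2 p.1 r i))
      (fun r _ => hsum r _)
    rwa [abs_of_nonneg (sub_nonneg.2 hab), mul_comm] at h
  calc |∫ p, (∫ r in a..b, ∑ i, F (r, lambertFlow (Torus.geometry (Fin 3)) (hsDiameter σ N) p.2 p.1 r i))
        ∂((localGibbsLaw σ a₀ u₀ θ₀ N Φ).prod (lambertNoise (Fin 3)))|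
      = ‖∫ p, (∫ r in a..b, ∑ i, F (r, lambertFlow (Torus.geometry (Fin 3)) (hsDiameter σ N) p.2 p.1 r i))
        ∂((localGibbsLaw σ a₀ u₀ θ₀ N Φ).prod (lambertNoise (Fin 3)))‖ := (Real.norm_eq_abs _).symm
    _ ≤ (b - a) * (((N : ℝ) + 1) * B) *
        (((localGibbsLaw σ a₀ u₀ θ₀ N Φ).prod (lambertNoise (Fin 3))) Set.univ).toReal :=
          norm_integral_le_of_norm_le_const (Eventually.of_forall hpath)
    _ = (b - a) * (((N : ℝ) + 1) * B) := by rw [measure_univ, ENNReal.toReal_one, mul_one]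

/-- Along `Λ`, a bounded measurable observable is interval integrable in time on every path (joint measurability of `Λ`, p128074).
[folklore] -/
theorem intervalIntegrable_path (hσ : 0 < σ) (hσ' : σ < 2⁻¹) {F : ℝ × (T3 × V3) → ℝ} (hFm : Measurable F) {B : ℝ}
    (hB : ∀ q, |F q| ≤ B) (p : Config (N + 1) (Fin 3) T3 × (ℕ → V3)) (a b : ℝ) :
    IntervalIntegrable (fun r => ∑ i, F (r, lambertFlow (Torus.geometry (Fin 3)) (hsDiameter σ N) p.2 p.1 r i)) volume a b := by
  have hΛ := LambertianContactSwapLambertianEulerJointMeasurable.measurable_lambertFlow_uncurry_torus hσ.le hσ' N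
  have hpr : Measurable fun r : ℝ => (p, r) := measurable_const.prodMk measurable_id
  have hr : Measurable fun r : ℝ => lambertFlow (Torus.geometry (Fin 3)) (hsDiameter σ N) p.2 p.1 r := by
    show Measurable ((fun q : (Config (N + 1) (Fin 3) T3 × (ℕ → V3)) × ℝ =>
      lambertFlow (Torus.geometry (Fin 3)) (hsDiameter σ N) q.1.2 q.1.1 q.2) ∘ (fun r : ℝ => (p, r)))
    exact hΛ.comp hpr
  have hm : Measurable fun r : ℝ => ∑ i, F (r, lambertFlow (Torus.geometry (Fin 3)) (hsDiameter σ N) p.2 p.1 r i) := by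
    refine Finset.measurable_sum _ fun i _ => ?_
    have hi : Measurable fun r : ℝ => lambertFlow (Torus.geometry (Fin 3)) (hsDiameter σ N) p.2 p.1 r i :=
      (measurable_pi_apply i).comp hr
    exact hFm.comp (measurable_id.prodMk hi)
  have hsum : ∀ r : ℝ, ‖∑ i, F (r, lambertFlow (Torus.geometry (Fin 3)) (hsDiameter σ N) p.2 p.1 r i)‖ ≤ ((N : ℝ) + 1) * B := by
    intro r
    rw [Real.norm_eq_abs]
    calc |∑ i, F (r, lambertFlow (Torus.geometry (Fin 3)) (hsDiameter σ N) p.2 p.1 r i)|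
        ≤ ∑ i, |F (r, lambertFlow (Torus.geometry (Fin 3)) (hsDiameter σ N) p.2 p.1 r i)| := Finset.abs_sum_le_sum_abs _ _
      _ ≤ ∑ _i : Fin (N + 1), B := Finset.sum_le_sum fun i _ => hB _
      _ = ((N : ℝ) + 1) * B := by
          simp only [Finset.sum_const, Finset.card_univ, Fintype.card_fin, nsmul_eq_mul, Nat.cast_add, Nat.cast_one]
  exact (Measure.integrableOn_of_bounded (s := Set.uIcc a b) isCompact_uIcc.measure_lt_top.ne hm.aestronglyMeasurable
    (Eventually.of_forall hsum)).intervalIntegrable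

/-- **Splitting a window functional into `m` equal windows**: for a bounded measurable observable and `m ≠ 0`,
`E_λ[∫_s^{s′} Σ_i F] = Σ_{k<m} E_λ[∫_{s+kh}^{s+(k+1)h} Σ_i F]`, `h = (s′−s)/m` (pathwise additivity over adjacent intervals, then
`∫ Σ = Σ ∫`, each window functional being integrable). [folklore] -/
theorem window_sum_eq (hσ : 0 < σ) (hσ' : σ < 2⁻¹) (ha : Continuous a₀) (hθ : Continuous θ₀) (hu : Continuous u₀)
    (ha0 : ∀ x, 0 < a₀ x) (hθ0 : ∀ x, 0 < θ₀ x)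
    (Φ : HardSphereFlow (Torus.geometry (Fin 3)) (hsDiameter σ N) (N + 1)) {F : ℝ × (T3 × V3) → ℝ} (hFm : Measurable F)
    {B : ℝ} (hB : ∀ q, |F q| ≤ B) {s s' : ℝ} (hss' : s ≤ s') {m : ℕ} (hm : m ≠ 0) :
    (∫ p, (∫ r in s..s', ∑ i, F (r, lambertFlow (Torus.geometry (Fin 3)) (hsDiameter σ N) p.2 p.1 r i))
        ∂((localGibbsLaw σ a₀ u₀ θ₀ N Φ).prod (lambertNoise (Fin 3)))) =
      ∑ k ∈ Finset.range m, ∫ p, (∫ r in (s + k * ((s' - s) / m))..(s + (k + 1) * ((s' - s) / m)),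
        ∑ i, F (r, lambertFlow (Torus.geometry (Fin 3)) (hsDiameter σ N) p.2 p.1 r i))
          ∂((localGibbsLaw σ a₀ u₀ θ₀ N Φ).prod (lambertNoise (Fin 3))) := by
  have hmpos : (0 : ℝ) < m := by exact_mod_cast Nat.pos_of_ne_zero hm
  have hh : 0 ≤ (s' - s) / m := div_nonneg (sub_nonneg.2 hss') hmpos.le
  have hB0 : 0 ≤ B := (abs_nonneg _).trans (hB (0, ((0 : T3), (0 : V3))))
  have hcub : ∀ (a b : ℝ), ∀ r ∈ Set.Icc a b, ∀ y : T3 × V3, |F (r, y)| ≤ B * (1 + ‖y.2‖) ^ 3 := by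
    intro a b r _ y
    refine (hB _).trans ?_
    have h1 : (1 : ℝ) ≤ (1 + ‖y.2‖) ^ 3 := one_le_pow₀ (by linarith [norm_nonneg y.2])
    nlinarith
  -- each window functional is integrable
  have hIk : ∀ k : ℕ, Integrable (fun p : Config (N + 1) (Fin 3) T3 × (ℕ → V3) =>
      ∫ r in (s + k * ((s' - s) / m))..(s + (k + 1) * ((s' - s) / m)),
        ∑ i, F (r, lambertFlow (Torus.geometry (Fin 3)) (hsDiameter σ N) p.2 p.1 r i))
      ((localGibbsLaw σ a₀ u₀ θ₀ N Φ).prod (lambertNoise (Fin 3))) := by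
    intro k
    have hle : s + k * ((s' - s) / m) ≤ s + (k + 1) * ((s' - s) / m) := by nlinarith
    exact (integrable_window_functional hσ hσ' ha hθ hu ha0 hθ0 Φ hFm hle hB0 (hcub _ _)).2.1
  -- pathwise additivity over the adjacent windows
  have hsplit : ∀ p : Config (N + 1) (Fin 3) T3 × (ℕ → V3),
      (∫ r in s..s', ∑ i, F (r, lambertFlow (Torus.geometry (Fin 3)) (hsDiameter σ N) p.2 p.1 r i)) =
        ∑ k ∈ Finset.range m, ∫ r in (s + k * ((s' - s) / m))..(s + (k + 1) * ((s' - s) / m)),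
          ∑ i, F (r, lambertFlow (Torus.geometry (Fin 3)) (hsDiameter σ N) p.2 p.1 r i) := by
    intro p
    have h := intervalIntegral.sum_integral_adjacent_intervals (μ := volume) (a := fun k : ℕ => s + k * ((s' - s) / m))
      (f := fun r => ∑ i, F (r, lambertFlow (Torus.geometry (Fin 3)) (hsDiameter σ N) p.2 p.1 r i)) (n := m)
      (fun k _ => intervalIntegrable_path hσ hσ' hFm hB p _ _)
    have hend : s + (m : ℝ) * ((s' - s) / m) = s' := by field_simp; ring
    simp only [Nat.cast_zero, zero_mul, add_zero, Nat.cast_add, Nat.cast_one, hend] at h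
    exact h.symm
  rw [integral_congr_ae (Eventually.of_forall hsplit), integral_finsetSum _ fun k _ => hIk k]

/-! ## §4 The entropy step per window -/

/-- **ENTROPY STEP PER WINDOW.** The window entropy inequality with restart (`window_entropyInequality_restart`, p136234) at rate
`β = γ/h`, with the entropy of the law of `Λ_a` w.r.t. the reference bounded by `M` and the log-moment-generating function of the restarted
window functional bounded by `Γ`: `−E_{P⊗γ^ℕ}[∫_a^{a+h} G(r, Λ_r) dr] ≤ (h/γ)(M + Γ)`. [cite: Yau1991, §2] -/
theorem neg_window_le_of_ent (hσ : 0 < σ) (hσ' : σ < 2⁻¹) (N : ℕ) (P R : Measure (Config (N + 1) (Fin 3) T3))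
    [IsProbabilityMeasure P] [IsProbabilityMeasure R] (hP : P ≪ liouville (Torus.geometry (Fin 3)) (N + 1) (hsDiameter σ N))
    (G : ℝ × Config (N + 1) (Fin 3) T3 → ℝ) (hG : Measurable G) (B : ℝ) (hB : ∀ x, |G x| ≤ B) {a h γ M Γ : ℝ}
    (ha : 0 ≤ a) (hh : 0 < h) (hγ : 0 < γ)
    (hfin : klDiv (((P.prod (lambertNoise (Fin 3))).map
        (fun p => lambertFlow (Torus.geometry (Fin 3)) (hsDiameter σ N) p.2 p.1 a))) R ≠ ⊤)
    (hM : (klDiv (((P.prod (lambertNoise (Fin 3))).map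
        (fun p => lambertFlow (Torus.geometry (Fin 3)) (hsDiameter σ N) p.2 p.1 a))) R).toReal ≤ M)
    (hΓ : Real.log (∫ q, Real.exp (-(γ / h * ∫ r in (0 : ℝ)..h,
        G (a + r, lambertFlow (Torus.geometry (Fin 3)) (hsDiameter σ N) q.2 q.1 r))) ∂(R.prod (lambertNoise (Fin 3)))) ≤ Γ) :
    -(∫ p, (∫ r in a..(a + h), G (r, lambertFlow (Torus.geometry (Fin 3)) (hsDiameter σ N) p.2 p.1 r))
        ∂((P.prod (lambertNoise (Fin 3))))) ≤ h / γ * (M + Γ) := by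
  have hβ : 0 < γ / h := div_pos hγ hh
  have h1 := window_entropyInequality_restart hσ hσ' N P R hP G hG B hB a h (γ / h) ha hh.le hβ hfin
  rw [inv_div] at h1
  exact h1.trans (mul_le_mul_of_nonneg_left (add_le_add hM hΓ) (div_nonneg hh.le hγ.le))

end Summit.AtomisticToContinuum.HydrodynamicLimit.Theorems.LambertianContactSwapLambertianEulerKineticWindowTools
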